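import Summits.QuantumFields.YangMills.Theorems.SwapVirialDeficitGnomonicTaylorTrChart
import HarnessLib

/-!
# W4, part K7g: JETS ALONG 001-LINES — BOTH free letters normalised by their E1 base (`x` by `√(1+⟪x,f_x⟫²)`, `y` by `√(1+⟪y,f_y⟫²)`), in the TRANSLATED chart
# (the `u`-uniform cubic datum of the 001 fibred law; free-hands support of ⟨stmt-QuantumFields-24197⟩ `SwapVirialDeficit.SwapGluedStiffness`; cell ym-idea-1,
# LEAD g99 order of work 21:25Z (c); assembler fcl-p3 g48 in w2 g59's K7e ∕ fcl-p3 g47's K7d-tr letters — ONE size estimate generalised, everything else verbatim)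

In the E1-rescaled 001 chart ✓`gnoFibreTrEquiv (u, gnoScaleTr u y)` (✓`…TrFibreRescaled`) the `x`-letter moves along lines whose direction is ORTHOGONAL to the flat unit
direction `f_x = (0, 1, −u₂)∕√(1+u₂²)` (its `f_x`-component stays `u₁`) and the `y`-letter along lines orthogonal to `f_y = (1, 0, 0)` (its axial component stays
`u₂`), with speeds up to `√(1+u₁²)·S` resp. `√(1+u₂²)·S`.  K7e's foot argument generalises from the axial direction `(ξ₀, 0, 0)` to ANY direction `ξ ⊥ f`, `f` a unit
vector: the foot of the perpendicular of the quaternion line `s ↦ (1, v + sξ)` keeps real part `1` and `f`-component `⟪v, f⟫`, so its norm is `≥ √(1 + ⟪v,f⟫²)`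
(Cauchy–Schwarz), and ✓`jet4_radialUnit_line` gives the letter a 4-jet of size `√Σξᵢ²∕√(1 + ⟪v,f⟫²)` — uniform after the E1 rescaling.  Everything else is K7d∕K7e:
* §1 ★ `sqrt_le_norm_foot_perp`, ★★ `jet4_gnoLetterLine_perp (ε) (v ξ f) (hf : Σfᵢ² = 1) (hξ : Σξᵢfᵢ = 0)` (size `√Σξᵢ²∕√(1+(Σvᵢfᵢ)²)`);
* §2 ★★ `jet4_leader_hubLine_perp` (every MASTER leader along the joint hub–letter line: size `2|δ₁|∕‖im a‖ + N_x + N_y + √Σ(ξ.2.1)²`, `N_x = √Σ(ξ.1.1)²∕√(1+⟪η.1.1,f_x⟫²)`,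
  `N_y = √Σ(ξ.1.2)²∕√(1+⟪η.1.2,f_y⟫²)`);
* §3 ★★ `realJet4_trGnoDeficit_hubLine_perp_le`, ★★★ `taylor_four_trGnoDeficit_hubLine_perp` — for `ψ(s) = trGnoDeficit u z χ (a − (sδ₁)·1) ε (η + sξ)` (unit `u`) with
  `ξ.1.1 ⊥ f_x`, `ξ.1.2 ⊥ f_y`, `|δ₁| ≤ S‖im a‖`, `√Σ(ξ.1.1)² ≤ S√(1+⟪η.1.1,f_x⟫²)`, `√Σ(ξ.1.2)² ≤ S√(1+⟪η.1.2,f_y⟫²)` and the other letter sizes `≤ S`: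
  `|ψ′| ≤ 1008L⁴S`, `|ψ″| ≤ 39984L⁴S²`, `|ψ‴| ≤ 6816096L⁴S³`, `|ψ⁗| ≤ 1464571584L⁴S⁴` everywhere, and the two Taylor remainders at `s = 0` (SAME constants as K7d;
  the translated leaders via g47's ✓`jet4_trLeaders_of_leaders`).

HONEST LABEL: calculus plumbing (no measure); nothing about ⟨24197⟩ ∕ ⟨24194⟩ (OPEN) or any rung is proved; item of record ⟨24085⟩ aside ∕ untouched; the Yang–Mills
mass gap is NOT proved; no summit is proved by a line.  THEOREMS ONLY (0 `def`, 0 `sorry`), standard axioms, no local instances.  Seat ym-line-fcl-p3 g48 (cell ym-idea-1,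
free hands), `--supports stmt-QuantumFields-24197`.  References: [cite: Luscher1983, §2]; [folklore].
-/

set_option autoImplicit false

noncomputable section

open Quaternion Set
open scoped Quaternion RealInnerProductSpace BigOperators
open Literature.MathematicalPhysics.QuantumLattice
open Literature.MathematicalPhysics.QuantumFieldTheory hiding SU2
open Literature.Analysis.Calculus (radialUnit radialUnit_def norm_radialUnit)
open Summit.QuantumFields.YangMills.Theorems.FemtoTransferGap
open Summit.QuantumFields.YangMills.Theorems.FemtoTransferGap.TT
open Summit.QuantumFields.YangMills.Theorems.SwapTwistDeficit.ToronLog (axisPoint)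
open Summit.QuantumFields.YangMills.Theorems.SwapVirialDeficit.ZeroModeSigma (su2Quat_quatToSU2_eq_radialUnit slaveP norm_axisUnit dil3 dil3_apply)
open Summit.QuantumFields.YangMills.Theorems.SwapVirialDeficit.BlowUp (leaderTuple dil3_one' dilateIm_one_apply qDeficit swapRingDeficit_eq_qDeficit)
open Summit.QuantumFields.YangMills.Theorems.SwapVirialDeficit.BlowUpRing

namespace Summit.QuantumFields.YangMills.Theorems.SwapVirialDeficit.Gnomonic

variable {L : ℕ} [NeZero L]

/-! ## §1 A gnomonic letter along a line orthogonal to a unit direction: the foot keeps the `f`-component -/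

omit [NeZero L] in
/-- ★ **THE FOOT OF A LINE ORTHOGONAL TO A UNIT DIRECTION**: for `Σfᵢ² = 1` and `ξ ⊥ f`, the foot of the perpendicular of `s ↦ (1, v + sξ)` keeps `re = 1` and `f`-component
`Σvᵢfᵢ`, hence has norm `≥ √(1 + (Σvᵢfᵢ)²)` (for ANY start `v`). [folklore] -/
theorem sqrt_le_norm_foot_perp (v ξ f : Fin 3 → ℝ) (hf : ∑ i, f i ^ 2 = 1) (hξ : ∑ i, ξ i * f i = 0) :
    Real.sqrt (1 + (∑ i, v i * f i) ^ 2) ≤ ‖gnomonicQuat v + (-(⟪gnomonicQuat v, gnomonicQuat ξ - 1⟫ / ‖gnomonicQuat ξ - 1‖ ^ 2)) • (gnomonicQuat ξ - 1)‖ := by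
  set c : ℝ := -(⟪gnomonicQuat v, gnomonicQuat ξ - 1⟫ / ‖gnomonicQuat ξ - 1‖ ^ 2) with hc
  have hre : (gnomonicQuat v + c • (gnomonicQuat ξ - 1)).re = 1 := by simp [gnomonicQuat]
  have hI : (gnomonicQuat v + c • (gnomonicQuat ξ - 1)).imI = v 0 + c * ξ 0 := by simp [gnomonicQuat]
  have hJ : (gnomonicQuat v + c • (gnomonicQuat ξ - 1)).imJ = v 1 + c * ξ 1 := by simp [gnomonicQuat]
  have hK : (gnomonicQuat v + c • (gnomonicQuat ξ - 1)).imK = v 2 + c * ξ 2 := by simp [gnomonicQuat]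
  rw [Fin.sum_univ_three] at hf hξ
  rw [Fin.sum_univ_three]
  have hproj : (v 0 + c * ξ 0) * f 0 + (v 1 + c * ξ 1) * f 1 + (v 2 + c * ξ 2) * f 2 = v 0 * f 0 + v 1 * f 1 + v 2 * f 2 := by
    have : c * (ξ 0 * f 0 + ξ 1 * f 1 + ξ 2 * f 2) = 0 := by rw [hξ, mul_zero]
    linarith [this]
  -- Cauchy–Schwarz in `ℝ³` (Lagrange's identity; cf. ✓`Literature.Geometry.Lorentzian.Kerr.sq_dot_le_three`)
  have hcs : ((v 0 + c * ξ 0) * f 0 + (v 1 + c * ξ 1) * f 1 + (v 2 + c * ξ 2) * f 2) ^ 2 ≤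
      ((v 0 + c * ξ 0) ^ 2 + (v 1 + c * ξ 1) ^ 2 + (v 2 + c * ξ 2) ^ 2) * (f 0 ^ 2 + f 1 ^ 2 + f 2 ^ 2) := by
    nlinarith [sq_nonneg ((v 0 + c * ξ 0) * f 1 - (v 1 + c * ξ 1) * f 0), sq_nonneg ((v 0 + c * ξ 0) * f 2 - (v 2 + c * ξ 2) * f 0),
      sq_nonneg ((v 1 + c * ξ 1) * f 2 - (v 2 + c * ξ 2) * f 1)]
  rw [hproj, hf, mul_one] at hcs
  have hsq : 1 + (v 0 * f 0 + v 1 * f 1 + v 2 * f 2) ^ 2 ≤ ‖gnomonicQuat v + c • (gnomonicQuat ξ - 1)‖ ^ 2 := by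
    have e : ‖gnomonicQuat v + c • (gnomonicQuat ξ - 1)‖ ^ 2 = Quaternion.normSq (gnomonicQuat v + c • (gnomonicQuat ξ - 1)) := by
      rw [Quaternion.normSq_eq_norm_mul_self, sq]
    rw [e, Quaternion.normSq_def', hre, hI, hJ, hK]
    nlinarith [hcs]
  calc Real.sqrt (1 + (v 0 * f 0 + v 1 * f 1 + v 2 * f 2) ^ 2) ≤ Real.sqrt (‖gnomonicQuat v + c • (gnomonicQuat ξ - 1)‖ ^ 2) := Real.sqrt_le_sqrt hsq
    _ = ‖gnomonicQuat v + c • (gnomonicQuat ξ - 1)‖ := Real.sqrt_sq (norm_nonneg _)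

omit [NeZero L] in
/-- ★★ **A GNOMONIC LETTER ALONG A LINE ORTHOGONAL TO A UNIT DIRECTION CARRIES A 4-JET OF SIZE `√Σξᵢ²∕√(1 + (Σvᵢfᵢ)²)`**: for `Σfᵢ² = 1`, `ξ ⊥ f`,
`s ↦ su2Quat (quatToSU2 (gnoLetter ε (v + s • ξ)))` has four derivatives with norms `≤ N, N², 3N³, 9N⁴`, `N = √Σξᵢ²∕√(1+(Σvᵢfᵢ)²)`
(✓`jet4_radialUnit_line` with the foot bound `sqrt_le_norm_foot_perp`; K7e's `jet4_gnoLetterLine_B` is the case `f = (0,·,·)`-free axial direction). [folklore] -/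
theorem jet4_gnoLetterLine_perp (ε : Bool) (v ξ f : Fin 3 → ℝ) (hf : ∑ i, f i ^ 2 = 1) (hξ : ∑ i, ξ i * f i = 0) :
    ∃ f₁ f₂ f₃ f₄ : ℝ → ℍ, (∀ s, HasDerivAt (fun s : ℝ => su2Quat (quatToSU2 (gnoLetter ε (v + s • ξ)))) (f₁ s) s) ∧ (∀ s, HasDerivAt f₁ (f₂ s) s) ∧
      (∀ s, HasDerivAt f₂ (f₃ s) s) ∧ (∀ s, HasDerivAt f₃ (f₄ s) s) ∧
      ∀ s, ‖su2Quat (quatToSU2 (gnoLetter ε (v + s • ξ)))‖ ≤ 1 ∧ ‖f₁ s‖ ≤ Real.sqrt (∑ i, ξ i ^ 2) / Real.sqrt (1 + (∑ i, v i * f i) ^ 2) ∧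
        ‖f₂ s‖ ≤ (Real.sqrt (∑ i, ξ i ^ 2) / Real.sqrt (1 + (∑ i, v i * f i) ^ 2)) ^ 2 ∧
        ‖f₃ s‖ ≤ 3 * (Real.sqrt (∑ i, ξ i ^ 2) / Real.sqrt (1 + (∑ i, v i * f i) ^ 2)) ^ 3 ∧
        ‖f₄ s‖ ≤ 9 * (Real.sqrt (∑ i, ξ i ^ 2) / Real.sqrt (1 + (∑ i, v i * f i) ^ 2)) ^ 4 := by
  set w : ℍ := gnomonicQuat ξ - 1 with hwdef
  set u₀' : ℍ := gnomonicQuat v + (-(⟪gnomonicQuat v, w⟫ / ‖w‖ ^ 2)) • w with hu₀'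
  have hfoot : u₀' ≠ 0 := foot_ne_zero v ξ
  have h := jet4_smul (abs_gnoSign ε) (jet4_radialUnit_line (u₀ := gnomonicQuat v) (w := w) hfoot)
  have hw : ‖w‖ = Real.sqrt (∑ i, ξ i ^ 2) := by rw [← norm_gnomonicQuat_sub_one ξ, norm_one, div_one]
  have hN : 0 < Real.sqrt (1 + (∑ i, v i * f i) ^ 2) := Real.sqrt_pos.2 (by positivity)
  have hsize : ‖w‖ / ‖u₀'‖ ≤ Real.sqrt (∑ i, ξ i ^ 2) / Real.sqrt (1 + (∑ i, v i * f i) ^ 2) := by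
    rw [← hw]
    exact div_le_div_of_nonneg_left (norm_nonneg _) hN (sqrt_le_norm_foot_perp v ξ f hf hξ)
  have h' := jet4_mono (by positivity) hsize h
  have e : ∀ s : ℝ, gnoSign ε • radialUnit (gnomonicQuat v + s • w) = su2Quat (quatToSU2 (gnoLetter ε (v + s • ξ))) := fun s => by
    rw [gnoLetter_eq, su2Quat_quatToSU2_smul_gnomonicQuat (abs_gnoSign ε), gnomonicQuat_add_smul]
  simpa only [e] using h'

/-! ## §2 Master leaders along the joint hub–letter line with two perpendicular letter directions -/

omit [NeZero L] in
/-- ★★ **LEADER JETS ALONG A JOINT HUB–LETTER 001-LINE**: for `im a ≠ 0`, unit directions `f_x, f_y` with `ξ.1.1 ⊥ f_x`, `ξ.1.2 ⊥ f_y`, every leader of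
`blowUpPoint 1 (gnomonicPoint (a − (sδ₁)·1) ε (η + s • ξ))` carries a 4-jet of size
`2|δ₁|∕‖im a‖ + √Σ(ξ.1.1)²∕√(1+(Ση.1.1ᵢf_xᵢ)²) + √Σ(ξ.1.2)²∕√(1+(Ση.1.2ᵢf_yᵢ)²) + √Σ(ξ.2.1)²` (K7d∕K7e with `jet4_gnoLetterLine_perp` on BOTH free letters). [folklore] -/
theorem jet4_leader_hubLine_perp {a : ℍ} (ha : a.im ≠ 0) (δ₁ : ℝ) (ε : BlowUpRing.GnoSign L) (η ξ : BlowUpRing.GnoCoord L) (fx fy : Fin 3 → ℝ)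
    (hfx : ∑ i, fx i ^ 2 = 1) (hfy : ∑ i, fy i ^ 2 = 1) (hξx : ∑ i, ξ.1.1 i * fx i = 0) (hξy : ∑ i, ξ.1.2 i * fy i = 0) (μ : Fin 4) :
    ∃ f₁ f₂ f₃ f₄ : ℝ → ℍ,
      (∀ s, HasDerivAt (fun s : ℝ => su2Quat ((BlowUpRing.blowUpPoint (L := L) 1 (BlowUpRing.gnomonicPoint (a - (s * δ₁) • (1 : ℍ)) ε (η + s • ξ))).1 μ)) (f₁ s) s) ∧
      (∀ s, HasDerivAt f₁ (f₂ s) s) ∧ (∀ s, HasDerivAt f₂ (f₃ s) s) ∧ (∀ s, HasDerivAt f₃ (f₄ s) s) ∧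
      ∀ s, ‖su2Quat ((BlowUpRing.blowUpPoint (L := L) 1 (BlowUpRing.gnomonicPoint (a - (s * δ₁) • (1 : ℍ)) ε (η + s • ξ))).1 μ)‖ ≤ 1 ∧
        ‖f₁ s‖ ≤ 2 * (|δ₁| / ‖a.im‖) + Real.sqrt (∑ k, ξ.1.1 k ^ 2) / Real.sqrt (1 + (∑ i, η.1.1 i * fx i) ^ 2) +
          Real.sqrt (∑ k, ξ.1.2 k ^ 2) / Real.sqrt (1 + (∑ i, η.1.2 i * fy i) ^ 2) + Real.sqrt (∑ k, ξ.2.1 k ^ 2) ∧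
        ‖f₂ s‖ ≤ (2 * (|δ₁| / ‖a.im‖) + Real.sqrt (∑ k, ξ.1.1 k ^ 2) / Real.sqrt (1 + (∑ i, η.1.1 i * fx i) ^ 2) +
          Real.sqrt (∑ k, ξ.1.2 k ^ 2) / Real.sqrt (1 + (∑ i, η.1.2 i * fy i) ^ 2) + Real.sqrt (∑ k, ξ.2.1 k ^ 2)) ^ 2 ∧
        ‖f₃ s‖ ≤ 3 * (2 * (|δ₁| / ‖a.im‖) + Real.sqrt (∑ k, ξ.1.1 k ^ 2) / Real.sqrt (1 + (∑ i, η.1.1 i * fx i) ^ 2) +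
          Real.sqrt (∑ k, ξ.1.2 k ^ 2) / Real.sqrt (1 + (∑ i, η.1.2 i * fy i) ^ 2) + Real.sqrt (∑ k, ξ.2.1 k ^ 2)) ^ 3 ∧
        ‖f₄ s‖ ≤ 9 * (2 * (|δ₁| / ‖a.im‖) + Real.sqrt (∑ k, ξ.1.1 k ^ 2) / Real.sqrt (1 + (∑ i, η.1.1 i * fx i) ^ 2) +
          Real.sqrt (∑ k, ξ.1.2 k ^ 2) / Real.sqrt (1 + (∑ i, η.1.2 i * fy i) ^ 2) + Real.sqrt (∑ k, ξ.2.1 k ^ 2)) ^ 4 := by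
  have hH : 0 ≤ |δ₁| / ‖a.im‖ := by positivity
  have hx : 0 ≤ Real.sqrt (∑ k, ξ.1.1 k ^ 2) / Real.sqrt (1 + (∑ i, η.1.1 i * fx i) ^ 2) := by positivity
  have hy : 0 ≤ Real.sqrt (∑ k, ξ.1.2 k ^ 2) / Real.sqrt (1 + (∑ i, η.1.2 i * fy i) ^ 2) := by positivity
  have hz : 0 ≤ Real.sqrt (∑ k, ξ.2.1 k ^ 2) := Real.sqrt_nonneg _
  have ha0 : ∀ s : ℝ, a - (s * δ₁) • (1 : ℍ) ≠ 0 := fun s => sub_smul_one_ne_zero ha _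
  match μ with
  | ⟨0, _⟩ =>
    have e : ∀ s : ℝ, su2Quat (quatToSU2 (gnoLetter ε.1.1 (η.1.1 + s • ξ.1.1))) =
        su2Quat ((BlowUpRing.blowUpPoint (L := L) 1 (BlowUpRing.gnomonicPoint (a - (s * δ₁) • (1 : ℍ)) ε (η + s • ξ))).1 ⟨0, by omega⟩) := fun s => by
      show _ = su2Quat (leaderTuple (a - (s * δ₁) • (1 : ℍ)) (dil3 1 (BlowUpRing.gnomonicPoint (a - (s * δ₁) • (1 : ℍ)) ε (η + s • ξ)).2.1) 0)
      rw [(BlowUp.leaderTuple_apply _ _).1, dil3_one']; rfl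
    have h := jet4_mono hx (show _ ≤ 2 * (|δ₁| / ‖a.im‖) + Real.sqrt (∑ k, ξ.1.1 k ^ 2) / Real.sqrt (1 + (∑ i, η.1.1 i * fx i) ^ 2) +
        Real.sqrt (∑ k, ξ.1.2 k ^ 2) / Real.sqrt (1 + (∑ i, η.1.2 i * fy i) ^ 2) + Real.sqrt (∑ k, ξ.2.1 k ^ 2) by linarith)
      (jet4_gnoLetterLine_perp ε.1.1 η.1.1 ξ.1.1 fx hfx hξx)
    simpa only [e] using h
  | ⟨1, _⟩ =>
    have hA := jet4_hubAxis_line ha δ₁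
    have h3 := jet4_mul (by positivity) hz
      (jet4_mul (by positivity) hH (jet4_mul hH hx (jet4_star hA) (jet4_gnoLetterLine_perp ε.1.1 η.1.1 ξ.1.1 fx hfx hξx)) hA)
      (jet4_gnoLetterLine ε.2.1 η.2.1 ξ.2.1)
    have e : ∀ s : ℝ, star (radialUnit (axisPoint (a - (s * δ₁) • (1 : ℍ)))) * su2Quat (quatToSU2 (gnoLetter ε.1.1 (η.1.1 + s • ξ.1.1))) *
        radialUnit (axisPoint (a - (s * δ₁) • (1 : ℍ))) * su2Quat (quatToSU2 (gnoLetter ε.2.1 (η.2.1 + s • ξ.2.1))) =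
        su2Quat ((BlowUpRing.blowUpPoint (L := L) 1 (BlowUpRing.gnomonicPoint (a - (s * δ₁) • (1 : ℍ)) ε (η + s • ξ))).1 ⟨1, by omega⟩) := fun s => by
      rw [← su2Quat_quatToSU2_slaveP_mul (norm_axisUnit (ha0 s)) (gnoLetter_ne_zero _ _) (gnoLetter_ne_zero _ _)]
      show _ = su2Quat (leaderTuple (a - (s * δ₁) • (1 : ℍ)) (dil3 1 (BlowUpRing.gnomonicPoint (a - (s * δ₁) • (1 : ℍ)) ε (η + s • ξ)).2.1) 1)
      rw [(BlowUp.leaderTuple_apply _ _).2.1, dil3_one']; rfl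
    have h := jet4_mono (by positivity) (show |δ₁| / ‖a.im‖ + Real.sqrt (∑ k, ξ.1.1 k ^ 2) / Real.sqrt (1 + (∑ i, η.1.1 i * fx i) ^ 2) + |δ₁| / ‖a.im‖ +
        Real.sqrt (∑ k, ξ.2.1 k ^ 2) ≤
        2 * (|δ₁| / ‖a.im‖) + Real.sqrt (∑ k, ξ.1.1 k ^ 2) / Real.sqrt (1 + (∑ i, η.1.1 i * fx i) ^ 2) +
          Real.sqrt (∑ k, ξ.1.2 k ^ 2) / Real.sqrt (1 + (∑ i, η.1.2 i * fy i) ^ 2) + Real.sqrt (∑ k, ξ.2.1 k ^ 2) by linarith) h3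
    simpa only [e] using h
  | ⟨2, _⟩ =>
    have e : ∀ s : ℝ, su2Quat (quatToSU2 (gnoLetter ε.1.2 (η.1.2 + s • ξ.1.2))) =
        su2Quat ((BlowUpRing.blowUpPoint (L := L) 1 (BlowUpRing.gnomonicPoint (a - (s * δ₁) • (1 : ℍ)) ε (η + s • ξ))).1 ⟨2, by omega⟩) := fun s => by
      show _ = su2Quat (leaderTuple (a - (s * δ₁) • (1 : ℍ)) (dil3 1 (BlowUpRing.gnomonicPoint (a - (s * δ₁) • (1 : ℍ)) ε (η + s • ξ)).2.1) 2)
      rw [(BlowUp.leaderTuple_apply _ _).2.2.1, dil3_one']; rfl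
    have h := jet4_mono hy (show _ ≤ 2 * (|δ₁| / ‖a.im‖) + Real.sqrt (∑ k, ξ.1.1 k ^ 2) / Real.sqrt (1 + (∑ i, η.1.1 i * fx i) ^ 2) +
        Real.sqrt (∑ k, ξ.1.2 k ^ 2) / Real.sqrt (1 + (∑ i, η.1.2 i * fy i) ^ 2) + Real.sqrt (∑ k, ξ.2.1 k ^ 2) by linarith)
      (jet4_gnoLetterLine_perp ε.1.2 η.1.2 ξ.1.2 fy hfy hξy)
    simpa only [e] using h
  | ⟨3, _⟩ =>
    have e : ∀ s : ℝ, radialUnit (axisPoint (a - (s * δ₁) • (1 : ℍ))) =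
        su2Quat ((BlowUpRing.blowUpPoint (L := L) 1 (BlowUpRing.gnomonicPoint (a - (s * δ₁) • (1 : ℍ)) ε (η + s • ξ))).1 ⟨3, by omega⟩) := fun s => by
      show _ = su2Quat (leaderTuple (a - (s * δ₁) • (1 : ℍ)) (dil3 1 (BlowUpRing.gnomonicPoint (a - (s * δ₁) • (1 : ℍ)) ε (η + s • ξ)).2.1) 3)
      rw [(BlowUp.leaderTuple_apply _ _).2.2.2]; exact (su2Quat_quatToSU2_axisUnit (ha0 s)).symm
    have h := jet4_mono hH (show |δ₁| / ‖a.im‖ ≤ 2 * (|δ₁| / ‖a.im‖) + Real.sqrt (∑ k, ξ.1.1 k ^ 2) / Real.sqrt (1 + (∑ i, η.1.1 i * fx i) ^ 2) +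
        Real.sqrt (∑ k, ξ.1.2 k ^ 2) / Real.sqrt (1 + (∑ i, η.1.2 i * fy i) ^ 2) + Real.sqrt (∑ k, ξ.2.1 k ^ 2) by linarith) (jet4_hubAxis_line ha δ₁)
    simpa only [e] using h

/-! ## §3 The joint 4-jet of the TRANSLATED deficit along 001-lines and its Taylor data -/

set_option maxHeartbeats 400000 in
/-- ★★ **FOUR DERIVATIVE WITNESSES OF `s ↦ F̂ᵘ_{a − (sδ₁)·1, ε}(η + s·ξ)` ALONG A 001-LINE** (unit `u`, `im a ≠ 0`, `ξ.1.1 ⊥ f_x`, `ξ.1.2 ⊥ f_y` unit directions),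
bounded by `1008L⁴S`, `39984L⁴S²`, `6816096L⁴S³`, `1464571584L⁴S⁴` when `|δ₁| ≤ S·‖im a‖`, `√Σ(ξ.1.1)² ≤ S·√(1+(Ση.1.1ᵢf_xᵢ)²)`, `√Σ(ξ.1.2)² ≤ S·√(1+(Ση.1.2ᵢf_yᵢ)²)`
and the other letter sizes are `≤ S` (K7d-tr with `jet4_leader_hubLine_perp`, the translated leaders via ✓`jet4_trLeaders_of_leaders`). [cite: Luscher1983, §2] -/
theorem realJet4_trGnoDeficit_hubLine_perp_le {u : ℍ} (hu : ‖u‖ = 1) (z : Fin 3 → Bool) (χ : Site 3 L → SU2) {a : ℍ} (ha : a.im ≠ 0) (δ₁ : ℝ)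
    (ε : GnoSign L) (η ξ : GnoCoord L) (fx fy : Fin 3 → ℝ) (hfx : ∑ i, fx i ^ 2 = 1) (hfy : ∑ i, fy i ^ 2 = 1) (hξx : ∑ i, ξ.1.1 i * fx i = 0)
    (hξy : ∑ i, ξ.1.2 i * fy i = 0) {S : ℝ} (hS : 0 ≤ S) (hδ : |δ₁| ≤ S * ‖a.im‖)
    (hx : Real.sqrt (∑ k, ξ.1.1 k ^ 2) ≤ S * Real.sqrt (1 + (∑ i, η.1.1 i * fx i) ^ 2))
    (hy : Real.sqrt (∑ k, ξ.1.2 k ^ 2) ≤ S * Real.sqrt (1 + (∑ i, η.1.2 i * fy i) ^ 2))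
    (hz : Real.sqrt (∑ k, ξ.2.1 k ^ 2) ≤ S) (hf : ∀ i, Real.sqrt (∑ k, ξ.2.2 i k ^ 2) ≤ S) :
    ∃ d₁ d₂ d₃ d₄ : ℝ → ℝ, (∀ s, HasDerivAt (fun s : ℝ => trGnoDeficit u z χ (a - (s * δ₁) • (1 : ℍ)) ε (η + s • ξ)) (d₁ s) s) ∧
      (∀ s, HasDerivAt d₁ (d₂ s) s) ∧ (∀ s, HasDerivAt d₂ (d₃ s) s) ∧ (∀ s, HasDerivAt d₃ (d₄ s) s) ∧
      ∀ s, |d₁ s| ≤ 1008 * (L : ℝ) ^ 4 * S ∧ |d₂ s| ≤ 39984 * (L : ℝ) ^ 4 * S ^ 2 ∧ |d₃ s| ≤ 6816096 * (L : ℝ) ^ 4 * S ^ 3 ∧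
        |d₄ s| ≤ 1464571584 * (L : ℝ) ^ 4 * S ^ 4 := by
  have hn : 0 < ‖a.im‖ := norm_pos_iff.2 ha
  have hH : |δ₁| / ‖a.im‖ ≤ S := by rw [div_le_iff₀ hn]; exact hδ
  have hNx : 0 < Real.sqrt (1 + (∑ i, η.1.1 i * fx i) ^ 2) := Real.sqrt_pos.2 (by positivity)
  have hNy : 0 < Real.sqrt (1 + (∑ i, η.1.2 i * fy i) ^ 2) := Real.sqrt_pos.2 (by positivity)
  have hx' : Real.sqrt (∑ k, ξ.1.1 k ^ 2) / Real.sqrt (1 + (∑ i, η.1.1 i * fx i) ^ 2) ≤ S := by rw [div_le_iff₀ hNx]; exact hx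
  have hy' : Real.sqrt (∑ k, ξ.1.2 k ^ 2) / Real.sqrt (1 + (∑ i, η.1.2 i * fy i) ^ 2) ≤ S := by rw [div_le_iff₀ hNy]; exact hy
  -- the master letters: leaders `≤ 5S`, followers `≤ S`
  have hC₀ : ∀ μ : Fin 4, ∃ f₁ f₂ f₃ f₄ : ℝ → ℍ,
      (∀ s, HasDerivAt (fun s : ℝ => su2Quat ((blowUpPoint (L := L) 1
        (gnomonicPoint ((fun s : ℝ => a - (s * δ₁) • (1 : ℍ)) s) ε ((fun s : ℝ => η + s • ξ) s))).1 μ)) (f₁ s) s) ∧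
      (∀ s, HasDerivAt f₁ (f₂ s) s) ∧ (∀ s, HasDerivAt f₂ (f₃ s) s) ∧ (∀ s, HasDerivAt f₃ (f₄ s) s) ∧
      ∀ s, ‖su2Quat ((blowUpPoint (L := L) 1 (gnomonicPoint ((fun s : ℝ => a - (s * δ₁) • (1 : ℍ)) s) ε ((fun s : ℝ => η + s • ξ) s))).1 μ)‖ ≤ 1 ∧
        ‖f₁ s‖ ≤ 5 * S ∧ ‖f₂ s‖ ≤ (5 * S) ^ 2 ∧ ‖f₃ s‖ ≤ 3 * (5 * S) ^ 3 ∧ ‖f₄ s‖ ≤ 9 * (5 * S) ^ 4 :=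
    fun μ => jet4_mono (by positivity) (by linarith) (jet4_leader_hubLine_perp ha δ₁ ε η ξ fx fy hfx hfy hξx hξy μ)
  have hU₀ : ∀ i : Fol L, ∃ f₁ f₂ f₃ f₄ : ℝ → ℍ,
      (∀ s, HasDerivAt (fun s : ℝ => su2Quat ((blowUpPoint (L := L) 1
        (gnomonicPoint ((fun s : ℝ => a - (s * δ₁) • (1 : ℍ)) s) ε ((fun s : ℝ => η + s • ξ) s))).2 i)) (f₁ s) s) ∧
      (∀ s, HasDerivAt f₁ (f₂ s) s) ∧ (∀ s, HasDerivAt f₂ (f₃ s) s) ∧ (∀ s, HasDerivAt f₃ (f₄ s) s) ∧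
      ∀ s, ‖su2Quat ((blowUpPoint (L := L) 1 (gnomonicPoint ((fun s : ℝ => a - (s * δ₁) • (1 : ℍ)) s) ε ((fun s : ℝ => η + s • ξ) s))).2 i)‖ ≤ 1 ∧
        ‖f₁ s‖ ≤ S ∧ ‖f₂ s‖ ≤ S ^ 2 ∧ ‖f₃ s‖ ≤ 3 * S ^ 3 ∧ ‖f₄ s‖ ≤ 9 * S ^ 4 :=
    fun i => jet4_mono (Real.sqrt_nonneg _) (hf i) (jet4_follower_hubLine a δ₁ ε η ξ i)
  have hC := jet4_trLeaders_of_leaders (L := L) hu (fun s : ℝ => a - (s * δ₁) • (1 : ℍ)) ε (fun s => η + s • ξ) (by positivity : (0 : ℝ) ≤ 5 * S) hC₀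
  have hU := jet4_trFollowers_of_followers (L := L) u (fun s : ℝ => a - (s * δ₁) • (1 : ℍ)) ε (fun s => η + s • ξ) hU₀
  -- the words and the deficit
  obtain ⟨hl, hs⟩ := jet4_fixHistory (C := fun s => (blowUpPoint (L := L) 1 (trGnomonicPoint u (a - (s * δ₁) • (1 : ℍ)) ε (η + s • ξ))).1)
    (U := fun s => (blowUpPoint (L := L) 1 (trGnomonicPoint u (a - (s * δ₁) • (1 : ℍ)) ε (η + s • ξ))).2) χ (by positivity : (0 : ℝ) ≤ 5 * S) hS hC hU
  have e7 : 5 * S + S + S = 7 * S := by ring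
  rw [e7] at hl hs
  have h := realJet4_qDeficit_le (L := L) z (M := 7 * S) (by positivity)
    (Q := fun s => ((fun (i : Fin (2 * L - 1 + 1)) (e : Edge 3 L) =>
        su2Quat ((fixHistory (ringConfig χ (blowUpPoint (L := L) 1 (trGnomonicPoint u (a - (s * δ₁) • (1 : ℍ)) ε (η + s • ξ))))).1 i e)),
      fun x : Site 3 L => su2Quat ((fixHistory (ringConfig χ (blowUpPoint (L := L) 1 (trGnomonicPoint u (a - (s * δ₁) • (1 : ℍ)) ε (η + s • ξ))))).2 x)))
    (fun i e => hl i e) (fun x => hs x)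
  have e : (fun s : ℝ => trGnoDeficit u z χ (a - (s * δ₁) • (1 : ℍ)) ε (η + s • ξ)) = fun s => qDeficit z
      ((fun (i : Fin (2 * L - 1 + 1)) (e : Edge 3 L) =>
          su2Quat ((fixHistory (ringConfig χ (blowUpPoint (L := L) 1 (trGnomonicPoint u (a - (s * δ₁) • (1 : ℍ)) ε (η + s • ξ))))).1 i e)),
        fun x : Site 3 L => su2Quat ((fixHistory (ringConfig χ (blowUpPoint (L := L) 1 (trGnomonicPoint u (a - (s * δ₁) • (1 : ℍ)) ε (η + s • ξ))))).2 x)) :=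
    funext fun s => swapRingDeficit_eq_qDeficit z _
  rw [e]
  refine realJet4_mono ?_ ?_ ?_ ?_ h
  · nlinarith [pow_nonneg (Nat.cast_nonneg L : (0 : ℝ) ≤ L) 4]
  · nlinarith [pow_nonneg (Nat.cast_nonneg L : (0 : ℝ) ≤ L) 4, sq_nonneg S]
  · nlinarith [pow_nonneg (Nat.cast_nonneg L : (0 : ℝ) ≤ L) 4, pow_nonneg hS 3]
  · nlinarith [pow_nonneg (Nat.cast_nonneg L : (0 : ℝ) ≤ L) 4, pow_nonneg hS 4]

/-- ★★★ **THE TRANSLATED DEFICIT IS `C⁴`-BOUNDED ALONG 001-LINES WITH BOTH FREE LETTERS E1-NORMALISED** (the `u`-uniform Taylor data of the 001 fibres): for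
`im a ≠ 0`, a unit `u`, signs `ε`, base point `η`, direction `ξ` with `ξ.1.1 ⊥ f_x`, `ξ.1.2 ⊥ f_y` (`f_x, f_y` units), `√Σ(ξ.1.1)² ≤ S√(1+(Ση.1.1ᵢf_xᵢ)²)`,
`√Σ(ξ.1.2)² ≤ S√(1+(Ση.1.2ᵢf_yᵢ)²)`, the other letter sizes `≤ S`, hub speed `|δ₁| ≤ S‖im a‖`, and `ψ s = trGnoDeficit u z χ (a − (sδ₁)·1) ε (η + s • ξ)`:
`|ψ′| ≤ 1008L⁴S`, `|ψ″| ≤ 39984L⁴S²`, `|ψ‴| ≤ 6816096L⁴S³`, `|ψ⁗| ≤ 1464571584L⁴S⁴` EVERYWHERE, and at `s = 0` the two Taylor remainders. [cite: Luscher1983, §2] -/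
theorem taylor_four_trGnoDeficit_hubLine_perp {u : ℍ} (hu : ‖u‖ = 1) (z : Fin 3 → Bool) (χ : Site 3 L → SU2) {a : ℍ} (ha : a.im ≠ 0) (δ₁ : ℝ)
    (ε : GnoSign L) (η ξ : GnoCoord L) (fx fy : Fin 3 → ℝ) (hfx : ∑ i, fx i ^ 2 = 1) (hfy : ∑ i, fy i ^ 2 = 1) (hξx : ∑ i, ξ.1.1 i * fx i = 0)
    (hξy : ∑ i, ξ.1.2 i * fy i = 0) {S : ℝ} (hS : 0 ≤ S) (hδ : |δ₁| ≤ S * ‖a.im‖)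
    (hx : Real.sqrt (∑ k, ξ.1.1 k ^ 2) ≤ S * Real.sqrt (1 + (∑ i, η.1.1 i * fx i) ^ 2))
    (hy : Real.sqrt (∑ k, ξ.1.2 k ^ 2) ≤ S * Real.sqrt (1 + (∑ i, η.1.2 i * fy i) ^ 2))
    (hz : Real.sqrt (∑ k, ξ.2.1 k ^ 2) ≤ S) (hf : ∀ i, Real.sqrt (∑ k, ξ.2.2 i k ^ 2) ≤ S) :
    (∀ s, |deriv (fun s : ℝ => trGnoDeficit u z χ (a - (s * δ₁) • (1 : ℍ)) ε (η + s • ξ)) s| ≤ 1008 * (L : ℝ) ^ 4 * S ∧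
        |iteratedDeriv 2 (fun s : ℝ => trGnoDeficit u z χ (a - (s * δ₁) • (1 : ℍ)) ε (η + s • ξ)) s| ≤ 39984 * (L : ℝ) ^ 4 * S ^ 2 ∧
        |iteratedDeriv 3 (fun s : ℝ => trGnoDeficit u z χ (a - (s * δ₁) • (1 : ℍ)) ε (η + s • ξ)) s| ≤ 6816096 * (L : ℝ) ^ 4 * S ^ 3 ∧
        |iteratedDeriv 4 (fun s : ℝ => trGnoDeficit u z χ (a - (s * δ₁) • (1 : ℍ)) ε (η + s • ξ)) s| ≤ 1464571584 * (L : ℝ) ^ 4 * S ^ 4) ∧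
      |trGnoDeficit u z χ (a - δ₁ • (1 : ℍ)) ε (η + ξ) - trGnoDeficit u z χ a ε η -
          deriv (fun s : ℝ => trGnoDeficit u z χ (a - (s * δ₁) • (1 : ℍ)) ε (η + s • ξ)) 0 -
          iteratedDeriv 2 (fun s : ℝ => trGnoDeficit u z χ (a - (s * δ₁) • (1 : ℍ)) ε (η + s • ξ)) 0 / 2| ≤ 6816096 * (L : ℝ) ^ 4 * S ^ 3 / 2 ∧
      |trGnoDeficit u z χ (a - δ₁ • (1 : ℍ)) ε (η + ξ) - trGnoDeficit u z χ a ε η -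
          deriv (fun s : ℝ => trGnoDeficit u z χ (a - (s * δ₁) • (1 : ℍ)) ε (η + s • ξ)) 0 -
          iteratedDeriv 2 (fun s : ℝ => trGnoDeficit u z χ (a - (s * δ₁) • (1 : ℍ)) ε (η + s • ξ)) 0 / 2 -
          iteratedDeriv 3 (fun s : ℝ => trGnoDeficit u z χ (a - (s * δ₁) • (1 : ℍ)) ε (η + s • ξ)) 0 / 6| ≤ 1464571584 * (L : ℝ) ^ 4 * S ^ 4 / 6 := by
  obtain ⟨d₁, d₂, d₃, d₄, h₁, h₂, h₃, h₄, hb⟩ := realJet4_trGnoDeficit_hubLine_perp_le hu z χ ha δ₁ ε η ξ fx fy hfx hfy hξx hξy hS hδ hx hy hz hf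
  obtain ⟨e1, e2, e3, e4⟩ := iteratedDeriv_eq_of_hasDerivAt_chain h₁ h₂ h₃ h₄
  have e1' : trGnoDeficit u z χ (a - δ₁ • (1 : ℍ)) ε (η + ξ) = (fun s : ℝ => trGnoDeficit u z χ (a - (s * δ₁) • (1 : ℍ)) ε (η + s • ξ)) 1 := by
    simp only [one_smul, one_mul]
  have e0' : trGnoDeficit u z χ a ε η = (fun s : ℝ => trGnoDeficit u z χ (a - (s * δ₁) • (1 : ℍ)) ε (η + s • ξ)) 0 := by
    simp only [zero_smul, add_zero, zero_mul, sub_zero]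
  refine ⟨fun s => ?_, ?_, ?_⟩
  · rw [e1, e2, e3, e4]; exact hb s
  · rw [e1, e2, e1', e0']
    exact abs_taylor_three_remainder_le h₁ h₂ h₃ (fun s _ => (hb s).2.2.1)
  · rw [e1, e2, e3, e1', e0']
    exact abs_taylor_four_remainder_le h₁ h₂ h₃ h₄ (fun s _ => (hb s).2.2.2)

end Summit.QuantumFields.YangMills.Theorems.SwapVirialDeficit.Gnomonic

end
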